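import Summits.ABC.IUTFork.Joshi.TestGenuinePinsAnyQIdele
import Literature.IUT.LogVolume.TensorPacketCapsuleRegion
import HarnessLib

/-!
# Branch E TEST — the genuine-carrier PINS: a kernel NON-VACUITY CRITERION at label `0`

Proof-only Test file of the abc-iut cell, block E (rung LADDER-ABC:A2.E; seat abc-iut-E-t44, gen 3; AUTHORS-FIRST row on the
antecedent of this seat's `Joshi/TestGenuinePinsAnyQIdele.lean` p438843, opened by the second reader abc-iut-E-t56 g2, AUDITED
2026-08-26T11:12:41Z INFO I1: «inhabitation of `PinnedRegions ∧ KummerB` AT THE GENUINE CARRIERS is neither proved nor claimed»).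
**No side is taken** on [IUTchIII] Cor. 3.12 or on any author; 0 definitions, no `Prop` fact; parents BY NAME (abc-iut-w5-d230
`Cor312Vol.ThetaPinned`/`PinnedRegions`, DEFS-FROZEN; abc-iut-c312-1 `LogShells.Ind2`/`starAut`; abc-iut-c312-5 `logShellsDH`,
`PadicPresentation.comparison`; abc-iut-c312-3 `boxOf`/`sharpBoxDH`/`labelIdele`; abc-iut-c312-7 `settingPrVolSharp`; campaign-S
`normalizedPacket`/`dEquiv`). A vacuity certificate says a typed antecedent is uninhabited at one instantiation — nothing about print.

§1 (INTERFACE LEVEL, any `LatticeSituation S`, `Cor312.Setting P`, region operator `ρ`). `ThetaPinned S P ρ` = (hρ)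
«`ρ (Φ·Ψ) = Φ '' ρ Ψ` for every `Φ ∈ ⟨(Ind1) ∪ (Ind2)⟩` and EVERY datum `Ψ`» ∧ (pΘ) «`P.thetaRegion m = ρ ((S.col P.n).frobΨ m)`».
The star-action `S.L.starAut Φ v` by which `Φ` moves bad-place data reads ONLY the components `Φ j (v_ℚ(v))`, `j ∈ 𝔽_l^⋇`. Hence
for every `Φ` in the indeterminacy group with trivial star-action, (hρ) at `Ψ := frobΨ m` plus (pΘ) force
`Φ j vQ '' P.thetaRegion m j vQ = P.thetaRegion m j vQ` at EVERY `(j, v_ℚ)` (`image_thetaRegion_eq_of_thetaPinned`; with (pq′) also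
`Φ '' P.qRegion = P.qRegion`). The label `0 ∉ 𝔽_l^⋇` is never read, and «`φ` at `(0, v_ℚ)`, identity elsewhere» is an (Ind2)-family with
trivial star-action (`exists_starTrivial_of_mem_ind2_zero`), so **the pins force both pilot regions AT LABEL `0` to be stable under
EVERY (Ind2)-move** (`image_thetaRegion_zero_eq_of_thetaPinned`, `image_qRegion_zero_eq_of_pinnedRegions`); contrapositively ONE
(Ind2)-move at label `0` moving one Kummer image of the Θ-pilot makes `ThetaPinned`/`PinnedRegions`/`PinnedRegions3` FALSE FOR EVERY
`ρ`, `qK`, and every «pins ⟹ X» theorem vacuous at `(S, P)` (`not_thetaPinned_of_ind2_moves`, `not_pinnedRegions_of_ind2_moves`, `not_pinnedRegions3_of_ind2_moves`).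

§2 (THE GENUINE CARRIERS: `settingPrVolSharp` over `logShellsDH X logv`, all other binders free). At a prime `p` the label-`0`
Kummer image of the Θ-pilot is `e⁻¹(Π_{v⃗} (R_I)^∼)` (`thetaRegion_settingPrVolSharp_zero_inr`; the label idele at `0` is `1`,
Dupuy–Hilado §3.9 «`𝒪_{v⃗}` in the other degrees»); a pure tensor with integral summand coordinates lies in it, and if a pure tensor
lies in it then along every summand the product of its coordinate norms is `≤ 1` ([IUTchIV] Prop. 1.4 (i): `ψ((R_I)^∼)` is the
unit polydisc, `‖ψ(ι_i a)_s‖ = ‖a‖`). The DH-level (Ind2) at a finite place is `Real.ismDH logv v` = ALL bicontinuous `ℚ`-linear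
automorphisms of `K_v` mapping the log-shell `I_v` onto itself (Dupuy–Hilado §4.9). THEOREM
(`not_pinnedRegions_settingPrVolSharp_of_ismDH_moves_integer`): **if at ONE place `v₀ | p` ONE `g ∈ ismDH logv v₀` moves ONE local
integer out of the unit ball** (`‖φ_{v₀} x₀‖ ≤ 1 < ‖φ_{v₀}(g x₀)‖`, `φ` = the presentation at `p`), the summandwise move `⊗(⊕_v g_v)`
(`g_{v₀} = g`, identity elsewhere) `∈ Ind2 0 p` carries the integral pure tensor supported at `v₀` out of the label-`0` Θ-region,
so **for EVERY `ρ`, `qK`, column data, `Ψ`, ideles `t`, `tq`: `¬ PinnedRegions (ofShells (logShellsDH X logv) …) (settingPrVolSharp …) ρ qK`**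
(and `¬ ThetaPinned`, `¬ PinnedRegions3`): at such `F` the genuine-carrier records «(ii)(b)@n ∧ (pΘ) ∧ (pq′) ⟹ ¬S» (abc-iut-C-cert-1
p430714, abc-iut-E-t4 p436213, this seat's p438843) and «¬(S ∧ PinnedRegions3)» hold VACUOUSLY.

LOCATED, NOT PROVED HERE: `GL_{ℤ_p}(Λ)` stabilises a lattice `Λ′` iff `Λ′ ∈ p^ℤ·Λ`, and for the analytic logarithm
`I_v = (p*)⁻¹·log(𝒪_v^×) = p⁻¹𝔪_v` at a tamely ramified `v ∤ 2` (`2 ≤ e_v < p − 1`) with `𝒪_v ∉ p^ℤ·𝔪_v^{1−e_v}` — so the §2 hypothesis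
is expected to HOLD at every such place (kernel discharge = a separate row): with (hρ) over the star-invisible components and
(Ind2) = DH's lattice automorphisms (⊋ isometries) the Θ-pin is then unsatisfiable at these carriers, while an `𝒪_v`-stable
(isometric) Ism has no label-`0` obstruction. Which (Ind2) [IUTchIII] intends is E-LOCATION §L1's attach point — recorded, not
adjudicated. [claim: Mochizuki2012, status: disputed] [cite: DupuyHilado2025, §3.9, §4.9] [cite: Mochizuki2012, IUTchIV Prop. 1.4 (i) p. 13]
-/

noncomputable section

open Set Function NumberField IsDedekindDomain
open scoped Pointwise

namespace Summit.ABC.IUTFork.Joshi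

open Thm311 Thm311.Real Cor312 Cor312Vol Literature.IUT.LogThetaLattice Literature.IUT.LogVolume
  Literature.IUT.HodgeTheaters

/-! ## 1. Interface level: what the Θ-pin forces under star-invisible indeterminacies -/

section Interface

variable {T : ThetaIndex} (S : LatticeSituation T) (P : Cor312.Setting S.toSituation)
  (ρ : (∀ v : T.V, v ∈ T.Vbad → Set (S.L.StarPacket v)) → ∀ (j : T.Label) (vQ : T.VQ), Set (S.L.Packet j vQ))
  (qK : ∀ v : T.V, v ∈ T.Vbad → Set (S.L.StarPacket v))

/-- A packet-automorphism family whose star-action fixes every point fixes every bad-place datum. [folklore] -/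
theorem starAut_image_eq_of_forall_apply_eq {Φ : S.L.PacketAut}
    (hstar : ∀ (v : T.V) (_ : v ∈ T.Vbad) (x : S.L.StarPacket v), S.L.starAut Φ v x = x)
    (Ψ : ∀ v : T.V, v ∈ T.Vbad → Set (S.L.StarPacket v)) :
    (fun v hv => S.L.starAut Φ v '' Ψ v hv) = Ψ := by
  funext v hv
  conv_rhs => rw [← Set.image_id (Ψ v hv)]
  exact Set.image_congr fun x _ => hstar v hv x

/-- **The Θ-pin forces invariance of EVERY Kummer image of the Θ-pilot under every indeterminacy with trivial star-action**
((hρ) at `Ψ := (S.col P.n).frobΨ m`, which such a `Φ` cannot move, and (pΘ)). [claim: Mochizuki2012, status: disputed] -/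
theorem image_thetaRegion_eq_of_thetaPinned (hΘ : ThetaPinned S P ρ) {Φ : S.L.PacketAut}
    (hΦ : Φ ∈ Subgroup.closure (S.L.Ind1Family ∪ S.L.Ind2Family))
    (hstar : ∀ (v : T.V) (_ : v ∈ T.Vbad) (x : S.L.StarPacket v), S.L.starAut Φ v x = x)
    (m : ℤ) (j : T.Label) (vQ : T.VQ) :
    Φ j vQ '' P.thetaRegion m j vQ = P.thetaRegion m j vQ := by
  have key := hΘ.1 Φ hΦ ((S.col P.n).frobΨ m) j vQ
  rw [starAut_image_eq_of_forall_apply_eq S hstar] at key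
  rw [hΘ.2 m j vQ]
  exact key.symm

/-- With the q-pin as well, the q-pilot region is invariant under every such indeterminacy ((hρ) at `Ψ := qK` and (pq′)).
[claim: Mochizuki2012, status: disputed] -/
theorem image_qRegion_eq_of_pinnedRegions (hpin : PinnedRegions S P ρ qK) {Φ : S.L.PacketAut}
    (hΦ : Φ ∈ Subgroup.closure (S.L.Ind1Family ∪ S.L.Ind2Family))
    (hstar : ∀ (v : T.V) (_ : v ∈ T.Vbad) (x : S.L.StarPacket v), S.L.starAut Φ v x = x)
    (j : T.Label) (vQ : T.VQ) :
    Φ j vQ '' P.qRegion j vQ = P.qRegion j vQ := by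
  have key := hpin.1.1 Φ hΦ qK j vQ
  rw [starAut_image_eq_of_forall_apply_eq S hstar] at key
  rw [hpin.2 j vQ]
  exact key.symm

/-- The single-slot family «`φ` at `(0, v_ℚ)`, identity elsewhere» of an (Ind2)-move `φ` at label `0` lies in the indeterminacy
group and has trivial star-action (which reads only the labels of `𝔽_l^⋇`). [folklore] -/
theorem exists_starTrivial_of_mem_ind2_zero (vQ₀ : T.VQ) {φ : S.L.Packet 0 vQ₀ ≃ₗ[ℚ] S.L.Packet 0 vQ₀}
    (hφ : φ ∈ S.L.Ind2 0 vQ₀) :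
    ∃ Φ ∈ Subgroup.closure (S.L.Ind1Family ∪ S.L.Ind2Family),
      (∀ (v : T.V) (_ : v ∈ T.Vbad) (x : S.L.StarPacket v), S.L.starAut Φ v x = x) ∧ Φ 0 vQ₀ = φ := by
  classical
  let Φ : S.L.PacketAut := Function.update (fun j vQ => LinearEquiv.refl ℚ (S.L.Packet j vQ)) 0
    (Function.update (fun vQ => LinearEquiv.refl ℚ (S.L.Packet 0 vQ)) vQ₀ φ)
  have hΦ0 : Φ 0 vQ₀ = φ := by simp only [Φ, Function.update_self]
  have hΦj : ∀ (j : T.Label), j ≠ 0 → ∀ vQ, Φ j vQ = LinearEquiv.refl ℚ _ := fun j hj vQ => by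
    simp only [Φ, Function.update_of_ne hj]
  have hΦv : ∀ vQ, vQ ≠ vQ₀ → Φ 0 vQ = LinearEquiv.refl ℚ _ := fun vQ hvQ => by
    simp only [Φ, Function.update_self, Function.update_of_ne hvQ]
  have hmem : Φ ∈ S.L.Ind2Family := by
    intro j vQ
    by_cases hj : j = 0
    · subst hj
      by_cases hvQ : vQ = vQ₀
      · subst hvQ; rw [hΦ0]; exact hφ
      · rw [hΦv vQ hvQ]; exact S.L.refl_mem_Ind2 0 vQ
    · rw [hΦj j hj vQ]; exact S.L.refl_mem_Ind2 j vQ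
  refine ⟨Φ, Subgroup.subset_closure (Or.inr hmem), fun v _ x => ?_, hΦ0⟩
  funext j
  show Φ j.1 (T.over v) (x j) = x j
  rw [hΦj j.1 j.2]
  rfl

/-- **At label `0` (never read by the star-action) the Θ-pin forces stability of every Kummer image of the Θ-pilot under EVERY
(Ind2)-move.** [claim: Mochizuki2012, status: disputed] -/
theorem image_thetaRegion_zero_eq_of_thetaPinned (hΘ : ThetaPinned S P ρ) (vQ₀ : T.VQ)
    {φ : S.L.Packet 0 vQ₀ ≃ₗ[ℚ] S.L.Packet 0 vQ₀} (hφ : φ ∈ S.L.Ind2 0 vQ₀) (m : ℤ) :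
    φ '' P.thetaRegion m 0 vQ₀ = P.thetaRegion m 0 vQ₀ := by
  obtain ⟨Φ, hcl, hstar, hΦ0⟩ := exists_starTrivial_of_mem_ind2_zero S vQ₀ hφ
  rw [← hΦ0]
  exact image_thetaRegion_eq_of_thetaPinned S P ρ hΘ hcl hstar m 0 vQ₀

/-- Likewise for the q-pilot region at label `0` under the two pins. [claim: Mochizuki2012, status: disputed] -/
theorem image_qRegion_zero_eq_of_pinnedRegions (hpin : PinnedRegions S P ρ qK) (vQ₀ : T.VQ)
    {φ : S.L.Packet 0 vQ₀ ≃ₗ[ℚ] S.L.Packet 0 vQ₀} (hφ : φ ∈ S.L.Ind2 0 vQ₀) :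
    φ '' P.qRegion 0 vQ₀ = P.qRegion 0 vQ₀ := by
  obtain ⟨Φ, hcl, hstar, hΦ0⟩ := exists_starTrivial_of_mem_ind2_zero S vQ₀ hφ
  rw [← hΦ0]
  exact image_qRegion_eq_of_pinnedRegions S P ρ qK hpin hcl hstar 0 vQ₀

/-- **Vacuity, contrapositive form**: one (Ind2)-move at label `0` moving one Kummer image of the Θ-pilot refutes the Θ-pin FOR
EVERY region operator `ρ`. [claim: Mochizuki2012, status: disputed] -/
theorem not_thetaPinned_of_ind2_moves {vQ₀ : T.VQ} {φ : S.L.Packet 0 vQ₀ ≃ₗ[ℚ] S.L.Packet 0 vQ₀}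
    (hφ : φ ∈ S.L.Ind2 0 vQ₀) {m : ℤ} (hne : φ '' P.thetaRegion m 0 vQ₀ ≠ P.thetaRegion m 0 vQ₀) :
    ¬ ThetaPinned S P ρ :=
  fun hΘ => hne (image_thetaRegion_zero_eq_of_thetaPinned S P ρ hΘ vQ₀ hφ m)

/-- … hence the two pins fail for every `ρ`, `qK` … [claim: Mochizuki2012, status: disputed] -/
theorem not_pinnedRegions_of_ind2_moves {vQ₀ : T.VQ} {φ : S.L.Packet 0 vQ₀ ≃ₗ[ℚ] S.L.Packet 0 vQ₀}
    (hφ : φ ∈ S.L.Ind2 0 vQ₀) {m : ℤ} (hne : φ '' P.thetaRegion m 0 vQ₀ ≠ P.thetaRegion m 0 vQ₀) :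
    ¬ PinnedRegions S P ρ qK :=
  fun h => not_thetaPinned_of_ind2_moves S P ρ hφ hne h.1

/-- … and so do the three pins … [claim: Mochizuki2012, status: disputed] -/
theorem not_pinnedRegions3_of_ind2_moves {vQ₀ : T.VQ} {φ : S.L.Packet 0 vQ₀ ≃ₗ[ℚ] S.L.Packet 0 vQ₀}
    (hφ : φ ∈ S.L.Ind2 0 vQ₀) {m : ℤ} (hne : φ '' P.thetaRegion m 0 vQ₀ ≠ P.thetaRegion m 0 vQ₀) :
    ¬ PinnedRegions3 S P ρ qK :=
  fun h => not_pinnedRegions_of_ind2_moves S P ρ qK hφ hne h.1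

end Interface

/-! ## 2. The genuine carriers: the label-`0` Θ-region of `settingPrVolSharp` and the (Ind2)-move that breaks the pin -/

section Genuine

variable {F : Type} [Field F] [NumberField F] (X : PilotData F) {logv : PadicLogs F} (hlog : LogvAnalytic logv)
  (M : Type) [Field M] [NumberField M]
  (archPk : ∀ (j : (thetaIndex X).Label) (vQ : (thetaIndex X).VQ), Set ((logShellsDH X logv).Packet j vQ))
  (archSub : ∀ (j : (thetaIndex X).Label) (v : (thetaIndex X).V),
    Set ((logShellsDH X logv).Packet j ((thetaIndex X).over v)))
  (Ψ : ℤ → ∀ v : (thetaIndex X).V, v ∈ (thetaIndex X).Vbad → Set ((logShellsDH X logv).StarPacket v))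
  (act : ℤ → ∀ v : (thetaIndex X).V, v ∈ (thetaIndex X).Vbad →
    (logShellsDH X logv).StarPacket v → Module.End ℚ ((logShellsDH X logv).StarPacket v))
  (Mmod : ℤ → ∀ j : (thetaIndex X).LabelStar, Set ((logShellsDH X logv).GlobalPacket j.1))
  (region : ℤ → ∀ j : (thetaIndex X).LabelStar, FinDivisor M → ∀ vQ : (thetaIndex X).VQ,
    Set ((logShellsDH X logv).Packet j.1 vQ))
  (frobAdm : ℤ → ℤ → ∀ (j : (thetaIndex X).Label) (vQ : (thetaIndex X).VQ),
    Set ((logShellsDH X logv).Packet j vQ) → Prop)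
  (frobLogvol : ℤ → ℤ → ∀ (j : (thetaIndex X).Label) (vQ : (thetaIndex X).VQ),
    Set ((logShellsDH X logv).Packet j vQ) → ℝ)
  (frobΨ : ℤ → ℤ → ∀ v : (thetaIndex X).V, v ∈ (thetaIndex X).Vbad → Set ((logShellsDH X logv).StarPacket v))
  (frobMmod : ℤ → ℤ → ∀ j : (thetaIndex X).LabelStar, Set ((logShellsDH X logv).GlobalPacket j.1))
  (unitImage : ℤ → ℤ → ℕ → ∀ (j : (thetaIndex X).Label) (vQ : (thetaIndex X).VQ),
    Set ((logShellsDH X logv).Packet j vQ))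
  (ballImage : ℤ → ℤ → ∀ (j : (thetaIndex X).Label) (vQ : (thetaIndex X).VQ),
    Set ((logShellsDH X logv).Packet j vQ))
  (thetaDiv : ℤ → ℤ → LgpDivisor M (thetaIndex X).lstar)
  (n : ℤ) {HT : Type} {LogLink : HT → HT → Type} {IsFull : ∀ {s t : HT}, LogLink s t → Prop}
  (lat : LGPGaussianLogThetaLattice LogLink IsFull)
  {Frd : Type} {IsoF : Frd → Frd → Type} {Ob : Frd → Type} {realify : Frd → Frd} {Strip : Type}
  {IsoS : Strip → Strip → Type} {Mv : ∀ v : (thetaIndex X).V, v ∈ (thetaIndex X).Vbad → Type}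
  [∀ v h, Monoid (Mv v h)]
  (sig : GlobalLGPFrobenioidSignature (thetaIndex X).lstar (thetaIndex X).V (· ∈ (thetaIndex X).Vbad)
    Frd IsoF Ob realify Strip IsoS Mv)
  (split : SplittingMonoids Mv) {ObΔ : Type} {N : ∀ v : (thetaIndex X).V, v ∈ (thetaIndex X).Vbad → Type}
  [∀ v h, Monoid (N v h)] (qData : QPilotData ObΔ N)
  (t : ∀ (pp : Nat.Primes) (_ : Fin X.lstar) (x : (thetaIndex X).Fibre (.inr pp)),
    haveI : Fact (pp : ℕ).Prime := ⟨pp.2⟩; kOf X pp.1 x)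
  (tq : ∀ (pp : Nat.Primes) (x : (thetaIndex X).Fibre (.inr pp)), haveI : Fact (pp : ℕ).Prime := ⟨pp.2⟩; kOf X pp.1 x)
  (ρ : (∀ v : (thetaIndex X).V, v ∈ (thetaIndex X).Vbad → Set ((logShellsDH X logv).StarPacket v)) →
    ∀ (j : (thetaIndex X).Label) (vQ : (thetaIndex X).VQ), Set ((logShellsDH X logv).Packet j vQ))
  (qK : ∀ v : (thetaIndex X).V, v ∈ (thetaIndex X).Vbad → Set ((logShellsDH X logv).StarPacket v))
  (htq0 : ∀ pp x, tq pp x ≠ 0)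
  (htq1 : ∀ (pp : Nat.Primes) (x : (thetaIndex X).Fibre (.inr pp)),
    haveI : Fact (pp : ℕ).Prime := ⟨pp.2⟩; placeOf X pp.1 x ∉ X.S → ‖tq pp x‖ = 1)

variable (p : ℕ) [Fact p.Prime] {I : Type} [Fintype I] [DecidableEq I] (k : I → Type)
  [∀ i, NontriviallyNormedField (k i)] [∀ i, NormedAlgebra ℚ_[p] (k i)]
omit [Fintype I] [DecidableEq I] in
/-- A pure tensor of local integers lies in `(R_I)^∼` (`R_I ⊆ (R_I)^∼`). [cite: Mochizuki2012, IUTchIV Prop. 1.1 p. 9] -/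
theorem purePacket_mem_normalizedPacket_of_norm_le {x : Π i, k i} (hx : ∀ i, ‖x i‖ ≤ 1) :
    purePacket p k x ∈ normalizedPacket p k :=
  integerPacket_le_normalizedPacket p k (purePacket_mem_integerPacket p k hx)

variable [∀ i, IsUltrametricDist (k i)] [∀ i, ProperSpace (k i)]

/-- If a pure tensor `⊗_i x_i` lies in `(R_I)^∼` then `Π_i ‖x_i‖ ≤ 1` (`ψ((R_I)^∼)` is the unit polydisc and `ψ(⊗ x)_s = Π_i ψ(ι_i x_i)_s`
has norm `Π_i ‖x_i‖`). [cite: Mochizuki2012, IUTchIV Prop. 1.4 (i) p. 13] -/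
theorem prod_norm_le_one_of_purePacket_mem_normalizedPacket [Nonempty I] {x : Π i, k i}
    (hx : purePacket p k x ∈ normalizedPacket p k) : ∏ i, ‖x i‖ ≤ 1 := by
  obtain ⟨s⟩ := (inferInstance : Nonempty (DIdx p k))
  have himg : dEquiv p k (purePacket p k x) ∈
      dEquiv p k '' (normalizedPacket p k : Set (PacketAlgebra p k)) := Set.mem_image_of_mem _ hx
  rw [image_normalizedPacket_eq_coe, coe_piUnitBallStructure, mem_polydisc] at himg
  have h := himg s
  rw [← prod_iota_eq_purePacket, map_prod, Finset.prod_apply, norm_prod] at h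
  simpa only [norm_dEquiv_iota] using h

/-- **At a prime `p`, every `(n,m)`-Kummer image of the Θ-pilot AT LABEL `0` is `e⁻¹(Π_{v⃗} (R_I)^∼)`** (the sharp summand region at
label `0` is `ι(1)·(R_I)^∼`: abc-iut-c312-3 `labelIdele` = `1` there, Dupuy–Hilado §3.9; `factorMap_preimage_boxOf`). [cite: DupuyHilado2025, §3.9] -/
theorem thetaRegion_settingPrVolSharp_zero_inr
    (m : ℤ) (pp : Nat.Primes) :
    haveI : Fact (pp : ℕ).Prime := ⟨pp.2⟩
    (settingPrVolSharp X hlog M archPk archSub Ψ act Mmod region n lat sig split qData tq t htq0 htq1).thetaRegion m 0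
        (.inr pp) =
      (presAt X hlog pp).comparison 0 ⁻¹' Set.pi univ
        fun e => (normalizedPacket pp.1 ((presAt X hlog pp).kk e) : Set ((presAt X hlog pp).X e)) := by
  haveI : Fact (pp : ℕ).Prime := ⟨pp.2⟩
  have h1 : ∀ x : (thetaIndex X).Fibre (.inr pp), labelIdele X t pp 0 x = 1 := fun x => by
    unfold labelIdele; exact dif_neg (by simp)
  have hbox : sharpBoxDH X hlog t pp 0 =
      fun e => (normalizedPacket pp.1 ((presAt X hlog pp).kk e) : Set ((presAt X hlog pp).X e)) := by
    funext e
    have h2 : iota pp.1 ((presAt X hlog pp).kk e) (Fin.last _) (labelIdele X t pp 0 (e (Fin.last _))) = 1 := by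
      rw [h1]; exact map_one _
    show iota pp.1 ((presAt X hlog pp).kk e) (Fin.last _) (labelIdele X t pp 0 (e (Fin.last _))) •
        (normalizedPacket pp.1 ((presAt X hlog pp).kk e) : Set ((presAt X hlog pp).X e)) = _
    rw [h2, one_smul]
  unfold settingPrVolSharp
  rw [thetaRegion_sharp_Pr]
  show (fun x => (presAt X hlog pp).factorMap 0 x) ⁻¹' (presAt X hlog pp).boxOf (sharpBoxDH X hlog t pp 0) = _
  rw [PadicPresentation.factorMap_preimage_boxOf, hbox]

/-- A pure tensor all of whose summand coordinates are local integers lies in the label-`0` Θ-region. [cite: DupuyHilado2025, §3.9] -/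
theorem tprod_mem_thetaRegion_settingPrVolSharp_zero
    (m : ℤ) (pp : Nat.Primes) (y : (thetaIndex X).Caps 0 → (logShellsDH X logv).Packet1 (.inr pp))
    (hy : haveI : Fact (pp : ℕ).Prime := ⟨pp.2⟩
      ∀ (a : (thetaIndex X).Caps 0) (v : (thetaIndex X).Fibre (.inr pp)), ‖(presAt X hlog pp).φ v (y a v)‖ ≤ 1) :
    (logShellsDH X logv).tprod 0 (.inr pp) y ∈
      (settingPrVolSharp X hlog M archPk archSub Ψ act Mmod region n lat sig split qData tq t htq0 htq1).thetaRegion m 0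
        (.inr pp) := by
  haveI : Fact (pp : ℕ).Prime := ⟨pp.2⟩
  rw [thetaRegion_settingPrVolSharp_zero_inr]
  show (presAt X hlog pp).comparison 0 (PiTensorProduct.tprod ℚ y) ∈ Set.pi univ _
  refine Set.mem_univ_pi.mpr fun e => ?_
  rw [PadicPresentation.comparison_tprod]
  exact purePacket_mem_normalizedPacket_of_norm_le pp.1 _ fun a => hy a (e a)

/-- If a pure tensor lies in the label-`0` Θ-region, along every summand the product of its coordinate norms is `≤ 1`.
[cite: Mochizuki2012, IUTchIV Prop. 1.4 (i) p. 13] -/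
theorem prod_norm_le_one_of_tprod_mem_thetaRegion_settingPrVolSharp_zero
    (m : ℤ) (pp : Nat.Primes) (y : (thetaIndex X).Caps 0 → (logShellsDH X logv).Packet1 (.inr pp))
    (hy : (logShellsDH X logv).tprod 0 (.inr pp) y ∈
      (settingPrVolSharp X hlog M archPk archSub Ψ act Mmod region n lat sig split qData tq t htq0 htq1).thetaRegion m 0
        (.inr pp))
    (e : (thetaIndex X).Caps 0 → (thetaIndex X).Fibre (.inr pp)) :
    haveI : Fact (pp : ℕ).Prime := ⟨pp.2⟩
    ∏ a, ‖(presAt X hlog pp).φ (e a) (y a (e a))‖ ≤ 1 := by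
  haveI : Fact (pp : ℕ).Prime := ⟨pp.2⟩
  haveI : Nonempty ((thetaIndex X).Caps 0) := ⟨0⟩
  rw [thetaRegion_settingPrVolSharp_zero_inr] at hy
  change (presAt X hlog pp).comparison 0 (PiTensorProduct.tprod ℚ y) ∈ Set.pi univ _ at hy
  have h := Set.mem_univ_pi.mp hy e
  rw [PadicPresentation.comparison_tprod] at h
  exact prod_norm_le_one_of_purePacket_mem_normalizedPacket pp.1 _ h

section Criterion

variable (pp : Nat.Primes) (v₀ : (thetaIndex X).Fibre (.inr pp))
  {g₀ : (logShellsDH X logv).carrier v₀.1 ≃ₗ[ℚ] (logShellsDH X logv).carrier v₀.1} (hg₀ : g₀ ∈ ismDH logv v₀.1)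
  {x₀ : (logShellsDH X logv).carrier v₀.1} (hx₀ : haveI : Fact (pp : ℕ).Prime := ⟨pp.2⟩; ‖(presAt X hlog pp).φ v₀ x₀‖ ≤ 1)
  (hgx₀ : haveI : Fact (pp : ℕ).Prime := ⟨pp.2⟩; 1 < ‖(presAt X hlog pp).φ v₀ (g₀ x₀)‖)

include hg₀ hx₀ hgx₀

/-- **NON-VACUITY CRITERION at the genuine carriers.** If at one place `v₀ | p` one `g₀ ∈ Real.ismDH logv v₀` (DH's (Ind2): all
bicontinuous `ℚ`-linear automorphisms of `K_{v₀}` mapping the log-shell onto itself, Dupuy–Hilado §4.9) moves one local integer out of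
the unit ball, then the summandwise (Ind2)-move `⊗(⊕_v g_v)` (`g_{v₀} = g₀`, identity elsewhere) at the slot `(0, p)` moves the
label-`0` Kummer image of the Θ-pilot of `settingPrVolSharp`. [cite: DupuyHilado2025, §3.9, §4.9] -/
theorem exists_ind2_moves_thetaRegion_settingPrVolSharp_zero (m : ℤ) :
    ∃ φ ∈ (logShellsDH X logv).Ind2 0 (.inr pp),
      φ '' (settingPrVolSharp X hlog M archPk archSub Ψ act Mmod region n lat sig split qData tq t htq0 htq1).thetaRegion
          m 0 (.inr pp) ≠
        (settingPrVolSharp X hlog M archPk archSub Ψ act Mmod region n lat sig split qData tq t htq0 htq1).thetaRegion m 0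
          (.inr pp) := by
  classical
  haveI : Fact (pp : ℕ).Prime := ⟨pp.2⟩
  haveI : Nonempty ((thetaIndex X).Caps 0) := ⟨0⟩
  -- the summandwise family: `g₀` at `v₀`, identity elsewhere
  let g : ∀ v : (thetaIndex X).Fibre (.inr pp),
      (logShellsDH X logv).carrier v.1 ≃ₗ[ℚ] (logShellsDH X logv).carrier v.1 :=
    Function.update (fun v => LinearEquiv.refl ℚ ((logShellsDH X logv).carrier v.1)) v₀ g₀
  have hgv₀ : g v₀ = g₀ := by simp only [g, Function.update_self]
  have hgv : ∀ v, v ≠ v₀ → g v = LinearEquiv.refl ℚ _ := fun v hv => by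
    simp only [g, Function.update_of_ne hv]
  have hg : ∀ v, g v ∈ (logShellsDH X logv).ism v.1 := fun v => by
    rcases eq_or_ne v₀ v with rfl | hv
    · rw [hgv₀]; exact hg₀
    · rw [hgv v (Ne.symm hv)]; exact refl_mem_ismDH logv v.1
  refine ⟨(logShellsDH X logv).factorwise 0 (.inr pp) fun _ => (logShellsDH X logv).summandwise (.inr pp) g,
    ⟨fun _ => g, fun _ v => hg v, rfl⟩, fun heq => ?_⟩
  -- the integral pure tensor supported at `v₀`
  let y : (thetaIndex X).Caps 0 → (logShellsDH X logv).Packet1 (.inr pp) := fun _ => Pi.single v₀ x₀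
  have hy : (logShellsDH X logv).tprod 0 (.inr pp) y ∈
      (settingPrVolSharp X hlog M archPk archSub Ψ act Mmod region n lat sig split qData tq t htq0 htq1).thetaRegion m 0
        (.inr pp) := by
    have haux : ∀ v : (thetaIndex X).Fibre (.inr pp),
        ‖(presAt X hlog pp).φ v ((Pi.single v₀ x₀ : (logShellsDH X logv).Packet1 (.inr pp)) v)‖ ≤ 1 := by
      intro v
      rcases eq_or_ne v₀ v with rfl | hv
      · rw [Pi.single_eq_same]; exact hx₀
      · rw [Pi.single_eq_of_ne (Ne.symm hv), map_zero, norm_zero]; exact zero_le_one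
    exact tprod_mem_thetaRegion_settingPrVolSharp_zero X hlog M archPk archSub Ψ act Mmod region n lat sig split qData t
      tq htq0 htq1 m pp y fun _ v => haux v
  -- its image under the move lies in the image of the region, hence (by `heq`) in the region …
  have himg : (logShellsDH X logv).factorwise 0 (.inr pp) (fun _ => (logShellsDH X logv).summandwise (.inr pp) g)
      ((logShellsDH X logv).tprod 0 (.inr pp) y) ∈
      (settingPrVolSharp X hlog M archPk archSub Ψ act Mmod region n lat sig split qData tq t htq0 htq1).thetaRegion m 0
        (.inr pp) := by
    rw [← heq]; exact Set.mem_image_of_mem _ hy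
  rw [LogShells.factorwise_summandwise_tprod] at himg
  -- … but along the constant summand `v⃗ = (v₀, …, v₀)` its coordinates all have norm `‖φ (g₀ x₀)‖ > 1`
  have hle := prod_norm_le_one_of_tprod_mem_thetaRegion_settingPrVolSharp_zero X hlog M archPk archSub Ψ act Mmod region n
    lat sig split qData t tq htq0 htq1 m pp _ himg (fun _ => v₀)
  simp only [y, Pi.single_eq_same, hgv₀, Finset.prod_const, Finset.card_univ] at hle
  have hlt : 1 < ‖(presAt X hlog pp).φ v₀ (g₀ x₀)‖ ^ Fintype.card ((thetaIndex X).Caps 0) :=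
    one_lt_pow₀ hgx₀ Fintype.card_ne_zero
  exact absurd hle (not_le.mpr hlt)

/-- **VACUITY OF THE GENUINE-CARRIER PINS under the criterion**: for EVERY region operator `ρ` the Θ-pin FAILS at
abc-iut-c312-7's `settingPrVolSharp` over abc-iut-c312-5's `LatticeSituation.ofShells (logShellsDH X logv) …` — whatever the column
data, `Ψ`, the ideles `t`, `tq` and the column `n`. [claim: Mochizuki2012, status: disputed] [cite: DupuyHilado2025, §4.9] -/
theorem not_thetaPinned_settingPrVolSharp_of_ismDH_moves_integer :
    ¬ Cor312Vol.ThetaPinned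
      (LatticeSituation.ofShells (logShellsDH X logv) M archPk archSub (summandPiecesPr X hlog).Adm
        (summandPiecesPr X hlog).logvol Ψ act Mmod region frobAdm frobLogvol frobΨ frobMmod unitImage ballImage thetaDiv)
      (settingPrVolSharp X hlog M archPk archSub Ψ act Mmod region n lat sig split qData tq t htq0 htq1) ρ := by
  obtain ⟨φ, hφ, hne⟩ := exists_ind2_moves_thetaRegion_settingPrVolSharp_zero X hlog M archPk archSub Ψ act Mmod region n
    lat sig split qData t tq htq0 htq1 pp v₀ hg₀ hx₀ hgx₀ 0
  refine not_thetaPinned_of_ind2_moves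
    (LatticeSituation.ofShells (logShellsDH X logv) M archPk archSub (summandPiecesPr X hlog).Adm
      (summandPiecesPr X hlog).logvol Ψ act Mmod region frobAdm frobLogvol frobΨ frobMmod unitImage ballImage thetaDiv)
    (settingPrVolSharp X hlog M archPk archSub Ψ act Mmod region n lat sig split qData tq t htq0 htq1) ρ
    (vQ₀ := .inr pp) (φ := φ) ?_ (m := 0) ?_
  · exact hφ
  · exact hne

/-- Hence, under the criterion, **`¬ Cor312Vol.PinnedRegions` at the genuine sharp setting FOR EVERY `ρ`, `qK`**: the records
«(ii)(b)@n ∧ (pΘ) ∧ (pq′) ⟹ ¬S» at these carriers (abc-iut-C-cert-1 p430714, abc-iut-E-t4 p436213, this seat's p438843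
`not_pilotKummerIndRelated_settingPrVolSharp_of_pinned_anyQ`) then hold VACUOUSLY. [claim: Mochizuki2012, status: disputed] -/
theorem not_pinnedRegions_settingPrVolSharp_of_ismDH_moves_integer :
    ¬ Cor312Vol.PinnedRegions
      (LatticeSituation.ofShells (logShellsDH X logv) M archPk archSub (summandPiecesPr X hlog).Adm
        (summandPiecesPr X hlog).logvol Ψ act Mmod region frobAdm frobLogvol frobΨ frobMmod unitImage ballImage thetaDiv)
      (settingPrVolSharp X hlog M archPk archSub Ψ act Mmod region n lat sig split qData tq t htq0 htq1) ρ qK :=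
  fun h => not_thetaPinned_settingPrVolSharp_of_ismDH_moves_integer X hlog M archPk archSub Ψ act Mmod region frobAdm
    frobLogvol frobΨ frobMmod unitImage ballImage thetaDiv n lat sig split qData t tq ρ htq0 htq1 pp v₀ hg₀ hx₀ hgx₀ h.1

/-- … and **`¬ Cor312Vol.PinnedRegions3`** likewise (so abc-iut-C-cert-1's `shrink1_antecedent_refuted_of_realising` and this
seat's `…_pinned3_anyQ` are vacuous there too). [claim: Mochizuki2012, status: disputed] -/
theorem not_pinnedRegions3_settingPrVolSharp_of_ismDH_moves_integer :
    ¬ Cor312Vol.PinnedRegions3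
      (LatticeSituation.ofShells (logShellsDH X logv) M archPk archSub (summandPiecesPr X hlog).Adm
        (summandPiecesPr X hlog).logvol Ψ act Mmod region frobAdm frobLogvol frobΨ frobMmod unitImage ballImage thetaDiv)
      (settingPrVolSharp X hlog M archPk archSub Ψ act Mmod region n lat sig split qData tq t htq0 htq1) ρ qK :=
  fun h => not_pinnedRegions_settingPrVolSharp_of_ismDH_moves_integer X hlog M archPk archSub Ψ act Mmod region frobAdm
    frobLogvol frobΨ frobMmod unitImage ballImage thetaDiv n lat sig split qData t tq ρ qK htq0 htq1 pp v₀ hg₀ hx₀ hgx₀ h.1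

end Criterion

end Genuine

end Summit.ABC.IUTFork.Joshi

end
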